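import Mathlib.NumberTheory.NumberField.Basic
import Mathlib.LinearAlgebra.FreeModule.PID
import HarnessLib

/-!
# A `ℤ`-submodule of a number field sandwiched between two multiples of `𝓞_K` is a full lattice

Topic `NumberTheory/NumberFields`; namespace `Literature.NumberTheory.NumberFields`.  Mathlib
only; theorems.

Let `K` be a number field of degree `d`, `O = 𝓞_K ⊆ K` (as the `ℤ`-span of an integral basis,
Mathlib `NumberField.integralBasis`, `mem_span_integralBasis`) and `Λ ⊆ K` a `ℤ`-submodule with
`N · O ⊆ Λ` and `N' · Λ ⊆ O` for non-zero integers `N, N'`.  Then (`exists_basis_of_sandwich`)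
`Λ` is free of rank `d`: it has a `ℤ`-basis indexed by `Fin d` — a submodule of the free module
`O ≅ ℤ^d` over the PID `ℤ` is free (Mathlib `Submodule.basisOfPidOfLE`), of rank `d` since it
contains `N N' · O ≅ O`.  In coordinates (`exists_generators_of_sandwich`): there are
`b₁, …, b_d ∈ Λ` such that every `β ∈ Λ` is `∑ mᵢ bᵢ` for a UNIQUE `m ∈ ℤ^d`.

Use: the unipotent parts `Γ ∩ N(K) ≅ Λ` of arithmetic subgroups of the Borel subgroup of `GL₂/K`
(there `Λ` is a fractional ideal) are free abelian of rank `d` [Harder1987, §2].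

## References

* J. Neukirch, *Algebraic Number Theory* (1999), Ch. I, (2.10) and §4 (lattices)
  [NeukirchANT1999].
-/

noncomputable section

open NumberField Module

namespace Literature.NumberTheory.NumberFields

variable (K : Type*) [Field K] [NumberField K]

/-- `𝓞_K ⊆ K` as a `ℤ`-submodule: the `ℤ`-span of an integral basis. [folklore] -/
abbrev integerSubmodule : Submodule ℤ K := Submodule.span ℤ (Set.range (integralBasis K))

/-- Membership: `x ∈ 𝓞_K`. [folklore] -/
theorem mem_integerSubmodule_iff {x : K} :
    x ∈ integerSubmodule K ↔ x ∈ (algebraMap (𝓞 K) K).range :=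
  mem_span_integralBasis K

/-- The integral basis is `ℤ`-linearly independent. [folklore] -/
theorem linearIndependent_int_integralBasis :
    LinearIndependent ℤ (integralBasis K) :=
  (integralBasis K).linearIndependent.restrict_scalars' ℤ

/-- The `ℤ`-basis of `𝓞_K ⊆ K` given by the integral basis. [folklore] -/
def integerSubmoduleBasis : Basis (Free.ChooseBasisIndex ℤ (𝓞 K)) ℤ (integerSubmodule K) :=
  Basis.span (linearIndependent_int_integralBasis K)

/-- `rank_ℤ 𝓞_K = [K : ℚ]` for the submodule model. [folklore] -/
theorem finrank_integerSubmodule : finrank ℤ (integerSubmodule K) = finrank ℚ K := by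
  classical
  haveI := Fintype.ofFinite (Free.ChooseBasisIndex ℤ (𝓞 K))
  rw [finrank_eq_card_basis (integerSubmoduleBasis K), ← finrank_eq_card_basis (RingOfIntegers.basis K),
    RingOfIntegers.rank]

variable {K}

/-- Multiplication by a non-zero integer is a `ℤ`-linear automorphism onto its image: the
submodule `c • Λ = {c β}`. [folklore] -/
theorem finrank_map_mulLeft {c : ℤ} (hc : c ≠ 0) (Λ : Submodule ℤ K) [Module.Finite ℤ Λ] :
    finrank ℤ (Λ.map (LinearMap.lsmul ℤ K c)) = finrank ℤ Λ := by
  have hinj : Function.Injective (LinearMap.lsmul ℤ K c) := fun x y hxy => by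
    have : (c : K) * x = (c : K) * y := by simpa [LinearMap.lsmul_apply, zsmul_eq_mul] using hxy
    exact mul_left_cancel₀ (Int.cast_ne_zero.2 hc) this
  exact (LinearEquiv.finrank_eq (Submodule.equivMapOfInjective _ hinj Λ)).symm

/-- **A sandwiched `ℤ`-submodule of `K` is free of rank `[K : ℚ]`.**  If `N · 𝓞_K ⊆ Λ` and
`N' · Λ ⊆ 𝓞_K` with `N, N' ≠ 0`, then `Λ` has a `ℤ`-basis indexed by `Fin [K : ℚ]`.
[cite: NeukirchANT1999, Ch. I §4] -/
theorem exists_basis_of_sandwich (Λ : Submodule ℤ K) {N N' : ℤ} (hN : N ≠ 0) (hN' : N' ≠ 0)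
    (hlow : ∀ x ∈ integerSubmodule K, (N : K) * x ∈ Λ)
    (hup : ∀ β ∈ Λ, (N' : K) * β ∈ integerSubmodule K) :
    Nonempty (Basis (Fin (finrank ℚ K)) ℤ Λ) := by
  classical
  haveI := Fintype.ofFinite (Free.ChooseBasisIndex ℤ (𝓞 K))
  -- `M = N' Λ ≤ O`
  set M : Submodule ℤ K := Λ.map (LinearMap.lsmul ℤ K N') with hM
  have hMO : M ≤ integerSubmodule K := by
    rintro _ ⟨β, hβ, rfl⟩
    simpa [LinearMap.lsmul_apply, zsmul_eq_mul] using hup β hβ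
  -- a basis of `M` from the PID structure theorem
  obtain ⟨n, bM⟩ := Submodule.basisOfPidOfLE hMO (integerSubmoduleBasis K)
  -- `M ≅ Λ`
  have hinj : Function.Injective (LinearMap.lsmul ℤ K N') := fun x y hxy => by
    have : (N' : K) * x = (N' : K) * y := by simpa [LinearMap.lsmul_apply, zsmul_eq_mul] using hxy
    exact mul_left_cancel₀ (Int.cast_ne_zero.2 hN') this
  let e : Λ ≃ₗ[ℤ] M := Submodule.equivMapOfInjective _ hinj Λ
  -- the rank of `M` is `d`
  haveI : Module.Finite ℤ M := Module.Finite.of_basis bM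
  have hnM : finrank ℤ M = n := by rw [finrank_eq_card_basis bM, Fintype.card_fin]
  haveI : Module.Finite ℤ (integerSubmodule K) := Module.Finite.of_basis (integerSubmoduleBasis K)
  have hle : n ≤ finrank ℚ K := by
    rw [← hnM, ← finrank_integerSubmodule K]
    -- inside the finite free module `O`
    have h := Submodule.finrank_le (M.comap (integerSubmodule K).subtype)
    rwa [LinearEquiv.finrank_eq (Submodule.comapSubtypeEquivOfLe hMO)] at h
  have hge : finrank ℚ K ≤ n := by
    -- `N N' · O ≤ M`
    have hsub : (integerSubmodule K).map (LinearMap.lsmul ℤ K (N' * N)) ≤ M := by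
      rintro _ ⟨x, hx, rfl⟩
      refine ⟨(N : K) * x, hlow x hx, ?_⟩
      simp [LinearMap.lsmul_apply, zsmul_eq_mul, mul_assoc]
    have h1 : finrank ℤ ((integerSubmodule K).map (LinearMap.lsmul ℤ K (N' * N))) = finrank ℚ K := by
      rw [finrank_map_mulLeft (mul_ne_zero hN' hN), finrank_integerSubmodule]
    -- compare inside `M`
    haveI : Module.Finite ℤ ((integerSubmodule K).map (LinearMap.lsmul ℤ K (N' * N))) :=
      Module.Finite.map _ _
    have h2 := Submodule.finrank_le
      (((integerSubmodule K).map (LinearMap.lsmul ℤ K (N' * N))).comap M.subtype)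
    rw [LinearEquiv.finrank_eq (Submodule.comapSubtypeEquivOfLe hsub), h1, hnM] at h2
    exact h2
  have hn : n = finrank ℚ K := le_antisymm hle hge
  subst hn
  exact ⟨bM.map e.symm⟩

/-- **Coordinates**: `b₁, …, b_d ∈ Λ` such that every `β ∈ Λ` is uniquely `∑ mᵢ bᵢ`, `m ∈ ℤ^d`.
[cite: NeukirchANT1999, Ch. I §4] -/
theorem exists_generators_of_sandwich (Λ : Submodule ℤ K) {N N' : ℤ} (hN : N ≠ 0) (hN' : N' ≠ 0)
    (hlow : ∀ x ∈ integerSubmodule K, (N : K) * x ∈ Λ)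
    (hup : ∀ β ∈ Λ, (N' : K) * β ∈ integerSubmodule K) :
    ∃ b : Fin (finrank ℚ K) → K, (∀ i, b i ∈ Λ) ∧
      ∀ β ∈ Λ, ∃! m : Fin (finrank ℚ K) → ℤ, β = ∑ i, (m i : K) * b i := by
  obtain ⟨bΛ⟩ := exists_basis_of_sandwich Λ hN hN' hlow hup
  refine ⟨fun i => (bΛ i : K), fun i => (bΛ i).2, fun β hβ => ?_⟩
  have hrepr : ∀ m : Fin (finrank ℚ K) → ℤ,
      (∑ i, (m i : K) * (bΛ i : K)) = ((∑ i, m i • bΛ i : Λ) : K) := fun m => by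
    rw [AddSubmonoidClass.coe_finsetSum]
    refine Finset.sum_congr rfl fun i _ => ?_
    rw [Submodule.coe_smul, zsmul_eq_mul]
  refine ⟨fun i => bΛ.repr ⟨β, hβ⟩ i, ?_, fun m hm => ?_⟩
  · change β = ∑ i, ((bΛ.repr ⟨β, hβ⟩ i : ℤ) : K) * (bΛ i : K)
    rw [hrepr]
    have := bΛ.sum_repr ⟨β, hβ⟩
    exact (congrArg Subtype.val this).symm
  · have hm' : β = ∑ i, (m i : K) * (bΛ i : K) := hm
    have hβm : (⟨β, hβ⟩ : Λ) = ∑ i, m i • bΛ i := Subtype.ext (by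
      change β = ((∑ i, m i • bΛ i : Λ) : K)
      rw [← hrepr]; exact hm')
    funext i
    have := congrArg (fun x => bΛ.repr x i) hβm
    simp only [map_sum, map_smul, Basis.repr_self, Finsupp.coe_finsetSum, Finset.sum_apply,
      Finsupp.smul_apply, Finsupp.single_apply, smul_eq_mul, mul_ite, mul_one, mul_zero,
      Finset.sum_ite_eq', Finset.mem_univ, if_true] at this
    exact this.symm

end Literature.NumberTheory.NumberFields
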